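import Summits.HodgeConjecture.HodgeConjecture.Theorems.F0P3cStCharTSFilteredNewton   -- ★ file 1∕2 (cosets): `injOn_of_newton`, `image_vadd_eq_of_newton`, `isTopologicalBasis_cosets`, …
import Mathlib.MeasureTheory.Measure.Haar.Basic
import Mathlib.MeasureTheory.Constructions.Polish.Basic
import Mathlib.MeasureTheory.Group.Action
import Mathlib.MeasureTheory.Integral.IntegrableOn
import HarnessLib

/-!
# F0 · P3c · line LH6 «StCharTS» — WIF antecedent, ELLIPTIC half via the ★ Cayley window: brick (C1b) «FILTERED NEWTON SANDWICH — HAAR» —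
# a map that is «the identity up to one level» on a filtered abelian group preserves Haar measure on the base box («the Jacobian on the box is `mod(L)`»)

Cell `pub/hodgecm-mathlib`, crux H413 = `stmt-HodgeConjecture-24833` (lane `--supports … --as helper`), route HCCMUnconditional; seat LH5-p02 (g6).
THEOREMS ONLY (no definition ∕ instance ∕ notation ∕ named fact ∕ `sorry`); Mathlib + ★ file 1∕2 `F0P3cStCharTSFilteredNewton` (whose setting, hypothesis
`(N)` ∕ `(N_L)` and road context are in force here verbatim).

THE RESULTS (all PROVED).
* §1 `map_restrict_eq_restrict_of_newton` — **`ψ` PRESERVES HAAR MEASURE on the base box**: `(μ.restrict (Λ k)).map ψ = μ.restrict (Λ k)` for every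
  left-invariant Borel measure finite on compacts (`V` second countable, `ψ` continuous on `Λ k`, `ψ 0 ∈ Λ k`): the two finite measures agree on the π-system
  of cosets `v + Λ j`, `j ≥ k` (★ `isPiSystem_cosets`, ★ `inter_preimage_vadd_eq_of_newton`), which is a topological basis (★ `isTopologicalBasis_cosets`)
  and therefore generates the Borel σ-algebra (Mathlib `IsTopologicalBasis.borel_eq_generateFrom`, `ext_of_generate_finite`);
  `measure_image_eq_of_newton` — `μ (ψ '' A) = μ A` for `A ⊆ Λ k` with Borel image; `measure_image_eq_of_newton_of_polish` — the same for every Borel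
  `A ⊆ Λ k` when `V` is Polish (Lusin–Souslin, Mathlib `MeasurableSet.image_of_continuousOn_injOn`).
* §2 linear part `L : V ≃ₜ+ W`: `map_restrict_eq_map_restrict_of_linearNewton` — `(μ.restrict (Λ k)).map φ = (μ.restrict (Λ k)).map L`;
  `map_measure_image_eq_of_linearNewton` — `(μ.map L) (φ '' A) = μ A`; `map_measure_image_equiv_eq` — `(μ.map L) (L '' A) = μ A` (bookkeeping).

HONEST LABEL: HC_CM is proved only modulo the 7 printed citations (2 remaining named inputs: hLiu418 = `stmt-HodgeConjecture-24832`, h413 =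
`stmt-HodgeConjecture-24833`) until rung 0 closes; this file closes no organ (count-neutral bank for the elliptic half of the WIF antecedent of RUNG0).

## References
* [Serre1992LALG] J.-P. Serre, *Lie Algebras and Lie Groups*, LNM 1500 (1992), Part II Ch. IV §8–§9 (standard groups and their filtrations). Context locator.
* [Weil1982] A. Weil, *Adeles and Algebraic Groups*, Progress in Math. 23 (1982), Ch. II §2.2 (local measures from gauge forms through congruence
  neighbourhoods — the change of variables this serves). Context locator.
* [HarishChandra1970] Harish-Chandra (notes by G. van Dijk), *Harmonic Analysis on Reductive p-adic Groups*, LNM 162 (1970), Lemma 22 (the consumer).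
-/

set_option autoImplicit false
set_option linter.dupNamespace false

open Set Filter MeasureTheory MeasureTheory.Measure TopologicalSpace
open Summit.HodgeConjecture.HodgeConjecture.Cruxes.H413.F0P3cStCharTSFilteredNewton
open scoped Pointwise Topology

namespace Summit.HodgeConjecture.HodgeConjecture.Cruxes.H413.F0P3cStCharTSFilteredNewtonHaar

/-! ## §1 Haar measure is preserved on the base box -/

section Measure

variable {V : Type*} [AddCommGroup V] [TopologicalSpace V] [IsTopologicalAddGroup V] [T2Space V]
  [MeasurableSpace V] [BorelSpace V]
  (Λ : ℕ → AddSubgroup V) {k : ℕ} (ψ : V → V)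
  (μ : Measure V) [IsFiniteMeasureOnCompacts μ] [μ.IsAddLeftInvariant]

/-- **Haar measure is preserved on the base box**: under the filtered Newton hypothesis at depth `k`, with `ψ`
continuous on `Λ k` and `ψ 0 ∈ Λ k`, the push-forward of `μ|_{Λ k}` by `ψ` is `μ|_{Λ k}` for every left-invariant
Borel measure `μ` finite on compacts (`V` second countable). [cite: Serre1992LALG, Part II Ch. IV §9] -/
theorem map_restrict_eq_restrict_of_newton [SecondCountableTopology V] (hanti : Antitone Λ)
    (hopen : ∀ j, IsOpen (Λ j : Set V))
    (hcomp : IsCompact (Λ k : Set V)) (hbasis : ∀ U ∈ 𝓝 (0 : V), ∃ j, (Λ j : Set V) ⊆ U)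
    (hψ : ContinuousOn ψ (Λ k : Set V))
    (hN : ∀ j, k ≤ j → ∀ x ∈ Λ k, ∀ y ∈ Λ j, ψ (x + y) - ψ x - y ∈ Λ (j + 1))
    (h0 : ψ 0 ∈ Λ k) :
    (μ.restrict (Λ k : Set V)).map ψ = μ.restrict (Λ k : Set V) := by
  have hΛk : MeasurableSet (Λ k : Set V) := (hopen k).measurableSet
  haveI : IsFiniteMeasure (μ.restrict (Λ k : Set V)) :=
    isFiniteMeasure_restrict.2 hcomp.measure_lt_top.ne
  have hae : AEMeasurable ψ (μ.restrict (Λ k : Set V)) := hψ.aemeasurable hΛk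
  haveI : IsFiniteMeasure ((μ.restrict (Λ k : Set V)).map ψ) := isFiniteMeasure_map _ _
  have himg := image_coe_eq_of_newton Λ ψ hanti hopen hcomp hbasis hψ hN h0
  refine ext_of_generate_finite {S : Set V | ∃ j, k ≤ j ∧ ∃ v : V, S = v +ᵥ (Λ j : Set V)} ?_
    (isPiSystem_cosets Λ hanti) ?_ ?_
  · rw [‹BorelSpace V›.measurable_eq]
    exact (isTopologicalBasis_cosets Λ hanti hopen hbasis).borel_eq_generateFrom
  · rintro _ ⟨j, hj, v, rfl⟩
    have hSm : MeasurableSet (v +ᵥ (Λ j : Set V)) := ((hopen j).vadd v).measurableSet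
    rw [map_apply_of_aemeasurable hae hSm, restrict_apply' hΛk, restrict_apply' hΛk, inter_comm]
    rcases vadd_coe_subset_or_disjoint Λ hanti hj v with hsub | hdis
    · -- the coset lies in the base box: `v = ψ x` with `x ∈ Λ k`
      have hv : v ∈ (Λ k : Set V) := hsub ⟨0, zero_mem _, by simp⟩
      rw [← himg] at hv
      obtain ⟨x, hx, rfl⟩ := hv
      rw [inter_preimage_vadd_eq_of_newton Λ ψ hanti hopen hcomp hbasis hψ hN hj hx,
        inter_eq_left.2 hsub, measure_vadd, measure_vadd]
    · -- the coset misses the base box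
      have hempty : (Λ k : Set V) ∩ ψ ⁻¹' (v +ᵥ (Λ j : Set V)) = ∅ := by
        refine Set.eq_empty_iff_forall_notMem.2 ?_
        rintro y ⟨hyk, hyS⟩
        have : ψ y ∈ (Λ k : Set V) := himg ▸ mem_image_of_mem ψ hyk
        exact Set.disjoint_left.1 hdis hyS this
      rw [hdis.inter_eq, hempty]
  · rw [map_apply_of_aemeasurable hae MeasurableSet.univ, preimage_univ]

/-- **Haar measure of images**: `μ (ψ '' A) = μ A` for every `A ⊆ Λ k` whose image is Borel. [cite: Serre1992LALG, Part II Ch. IV §9] -/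
theorem measure_image_eq_of_newton [SecondCountableTopology V] (hanti : Antitone Λ)
    (hopen : ∀ j, IsOpen (Λ j : Set V))
    (hcomp : IsCompact (Λ k : Set V)) (hbasis : ∀ U ∈ 𝓝 (0 : V), ∃ j, (Λ j : Set V) ⊆ U)
    (hψ : ContinuousOn ψ (Λ k : Set V))
    (hN : ∀ j, k ≤ j → ∀ x ∈ Λ k, ∀ y ∈ Λ j, ψ (x + y) - ψ x - y ∈ Λ (j + 1))
    (h0 : ψ 0 ∈ Λ k) {A : Set V} (hA : A ⊆ (Λ k : Set V)) (hAm : MeasurableSet (ψ '' A)) :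
    μ (ψ '' A) = μ A := by
  have hΛk : MeasurableSet (Λ k : Set V) := (hopen k).measurableSet
  have hae : AEMeasurable ψ (μ.restrict (Λ k : Set V)) := hψ.aemeasurable hΛk
  have himg := image_coe_eq_of_newton Λ ψ hanti hopen hcomp hbasis hψ hN h0
  have hsub : ψ '' A ⊆ (Λ k : Set V) := himg ▸ image_mono hA
  have key := congrArg (fun ν => ν (ψ '' A))
    (map_restrict_eq_restrict_of_newton Λ ψ μ hanti hopen hcomp hbasis hψ hN h0)
  rw [map_apply_of_aemeasurable hae hAm, restrict_apply' hΛk, restrict_apply' hΛk,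
    (injOn_of_newton Λ ψ hanti hbasis hN).preimage_image_inter hA, inter_eq_left.2 hsub] at key
  exact key.symm

/-- **Haar measure of images, Polish case** (the image of a Borel set under a map continuous and injective on
it is Borel — Lusin–Souslin, Mathlib): `μ (ψ '' A) = μ A` for every Borel `A ⊆ Λ k`. [cite: Serre1992LALG, Part II Ch. IV §9] -/
theorem measure_image_eq_of_newton_of_polish [PolishSpace V] (hanti : Antitone Λ)
    (hopen : ∀ j, IsOpen (Λ j : Set V))
    (hcomp : IsCompact (Λ k : Set V)) (hbasis : ∀ U ∈ 𝓝 (0 : V), ∃ j, (Λ j : Set V) ⊆ U)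
    (hψ : ContinuousOn ψ (Λ k : Set V))
    (hN : ∀ j, k ≤ j → ∀ x ∈ Λ k, ∀ y ∈ Λ j, ψ (x + y) - ψ x - y ∈ Λ (j + 1))
    (h0 : ψ 0 ∈ Λ k) {A : Set V} (hA : A ⊆ (Λ k : Set V)) (hAm : MeasurableSet A) :
    μ (ψ '' A) = μ A :=
  measure_image_eq_of_newton Λ ψ μ hanti hopen hcomp hbasis hψ hN h0 hA
    (hAm.image_of_continuousOn_injOn (hψ.mono hA) ((injOn_of_newton Λ ψ hanti hbasis hN).mono hA))

end Measure

/-! ## §2 The linear-part form -/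

section Linear

variable {V W : Type*} [AddCommGroup V] [TopologicalSpace V] [AddCommGroup W] [TopologicalSpace W]
  (Λ : ℕ → AddSubgroup V) {k : ℕ} (φ : V → W) (L : V ≃ₜ+ W)

variable [IsTopologicalAddGroup V] [T2Space V] [SecondCountableTopology V] [MeasurableSpace V] [BorelSpace V]
  [MeasurableSpace W] [BorelSpace W]
  (μ : Measure V) [IsFiniteMeasureOnCompacts μ] [μ.IsAddLeftInvariant]

/-- **«The Jacobian of `φ` on the box is that of `L`»**: the push-forwards of `μ|_{Λ k}` by `φ` and by `L` agree,
provided `L⁻¹ (φ 0) ∈ Λ k`. [cite: Serre1992LALG, Part II Ch. IV §9] -/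
theorem map_restrict_eq_map_restrict_of_linearNewton (hanti : Antitone Λ)
    (hopen : ∀ j, IsOpen (Λ j : Set V))
    (hcomp : IsCompact (Λ k : Set V)) (hbasis : ∀ U ∈ 𝓝 (0 : V), ∃ j, (Λ j : Set V) ⊆ U)
    (hφ : ContinuousOn φ (Λ k : Set V))
    (hN : ∀ j, k ≤ j → ∀ x ∈ Λ k, ∀ y ∈ Λ j, φ (x + y) - φ x - L y ∈ L '' (Λ (j + 1) : Set V))
    (h0 : L.symm (φ 0) ∈ Λ k) :
    (μ.restrict (Λ k : Set V)).map φ = (μ.restrict (Λ k : Set V)).map L := by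
  have hΛk : MeasurableSet (Λ k : Set V) := (hopen k).measurableSet
  have hψ : ContinuousOn (L.symm ∘ φ) (Λ k : Set V) := L.symm.continuous.comp_continuousOn hφ
  have key := map_restrict_eq_restrict_of_newton Λ (L.symm ∘ φ) μ hanti hopen hcomp hbasis hψ
    (newton_symm_comp_of_linearNewton Λ φ L hN) (by simpa using h0)
  have hLm : Measurable (L : V → W) := L.toHomeomorph.measurable
  have hφ_eq : φ = L ∘ (L.symm ∘ φ) := by ext; simp
  rw [hφ_eq, ← AEMeasurable.map_map_of_aemeasurable hLm.aemeasurable (hψ.aemeasurable hΛk), key]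

/-- **Measure of images, linear-part form**: for the transported measure `μ.map L` on `W` and `A ⊆ Λ k`
with Borel image, `(μ.map L) (φ '' A) = μ A` (which is also `(μ.map L) (L '' A)`, next lemma). [cite: Serre1992LALG, Part II Ch. IV §9] -/
theorem map_measure_image_eq_of_linearNewton (hanti : Antitone Λ)
    (hopen : ∀ j, IsOpen (Λ j : Set V))
    (hcomp : IsCompact (Λ k : Set V)) (hbasis : ∀ U ∈ 𝓝 (0 : V), ∃ j, (Λ j : Set V) ⊆ U)
    (hφ : ContinuousOn φ (Λ k : Set V))
    (hN : ∀ j, k ≤ j → ∀ x ∈ Λ k, ∀ y ∈ Λ j, φ (x + y) - φ x - L y ∈ L '' (Λ (j + 1) : Set V))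
    (h0 : L.symm (φ 0) ∈ Λ k) {A : Set V} (hA : A ⊆ (Λ k : Set V)) (hAm : MeasurableSet (φ '' A)) :
    (μ.map L) (φ '' A) = μ A := by
  have hLm : Measurable (L : V → W) := L.toHomeomorph.measurable
  have hψ : ContinuousOn (L.symm ∘ φ) (Λ k : Set V) := L.symm.continuous.comp_continuousOn hφ
  have hpre : L ⁻¹' (φ '' A) = (L.symm ∘ φ) '' A := by
    ext v; constructor
    · rintro ⟨a, ha, hav⟩
      exact ⟨a, ha, by rw [Function.comp_apply, hav]; simp⟩
    · rintro ⟨a, ha, rfl⟩; exact ⟨a, ha, by simp⟩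
  rw [map_apply hLm hAm, hpre]
  exact measure_image_eq_of_newton Λ (L.symm ∘ φ) μ hanti hopen hcomp hbasis hψ
    (newton_symm_comp_of_linearNewton Λ φ L hN) (by simpa using h0) hA (hpre ▸ hLm hAm)

omit [IsTopologicalAddGroup V] [T2Space V] [SecondCountableTopology V] [IsFiniteMeasureOnCompacts μ]
  [μ.IsAddLeftInvariant] in
/-- The transported measure of `L '' A` is `μ A` (bookkeeping companion of the previous statement). [cite: Serre1992LALG, Part II Ch. IV §9] -/
theorem map_measure_image_equiv_eq (A : Set V) (hAm : MeasurableSet A) : (μ.map L) (L '' A) = μ A := by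
  have hLm : Measurable (L : V → W) := L.toHomeomorph.measurable
  have hm : MeasurableSet (L '' A) := L.toHomeomorph.measurableEmbedding.measurableSet_image.2 hAm
  rw [map_apply hLm hm]
  exact congrArg μ (L.injective.preimage_image A)

end Linear

end Summit.HodgeConjecture.HodgeConjecture.Cruxes.H413.F0P3cStCharTSFilteredNewtonHaar
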